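import Summits.BirchSwinnertonDyer.BirchSwinnertonDyer.Theorems.GoldfeldK12AdditiveTwoInertSevenKrizLi7Twist
import Summits.BirchSwinnertonDyer.BirchSwinnertonDyer.Theorems.GoldfeldAllTwistsTwoConverseTwinAdditiveSign
import Summits.BirchSwinnertonDyer.Rank1Residual.X12.O11.RouteUMemberE4
import Summits.BirchSwinnertonDyer.Rank1Residual.X12.O11.RouteUMemberE8
import Summits.BirchSwinnertonDyer.Rank1Residual.X12.O11.RouteUMemberE88
import Summits.BirchSwinnertonDyer.BirchSwinnertonDyer.Theorems.GoldfeldK12AdditiveTwoInertSevenKrizLi7TwistMember29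
import Summits.BirchSwinnertonDyer.BirchSwinnertonDyer.Theorems.GoldfeldK12AdditiveTwoInertSevenKrizLi7TwistMember53
import HarnessLib

set_option linter.dupNamespace false -- namespace `…BirchSwinnertonDyer.BirchSwinnertonDyer…` is the cell's (D-0017 nested layout)
set_option autoImplicit false

/-!
# K12₂″, the 7-INERT half — «D(n)» over `ℚ` on the double-7-unit locus (BOTH halves), the inert LEAF's conclusion
# `ord L(X₀(49)/ℚ(√−n)) = 1` outright, and the members `n = 1, 2, 22`

Cell `bsd-goldfeld`, seat `bsd-goldfeld-s1p-c201` (prover, gen 8); `--supports` stmt-BirchSwinnertonDyer-20044 (K12₂″, RANK axis;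
registered stub `stub_inertHalfGenusNonTorsion`). Sequel (in the cell's Theses cone, through the sign law of
`…TwinAdditiveSign`) of the THESES-FREE class file `…GoldfeldK12AdditiveTwoInertSevenKrizLi7Twist` (p495876: Kriz–Li 2019
Thm. 1.20 at `p = 7` applied to the TWIST `W ≅ 49a1^{(−4n)}` over an auxiliary Heegner field `ℚ(√−r)`; A: the twist's Heegner
point is non-torsion; B: `r_an(W) + r_an(W^{(−r)}) = 1`; C: `r_an(W) = 1` given oddness). Here the oddness is DISCHARGED by the
sign law `w(49a1^{(d)}) = sign d` (`odd_analyticRank_of_smul_eq_quadraticTwist_cm7_of_neg`, c301 g3, from Modularity and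
Coates–Li–Tian–Zhai Thm. 1.2 at `R = 1`), so everything below is free of Selmer hypotheses:

* §1 **T2″ «D(n)»**: `ord_{s=1} L(W′, s) = 1` for EVERY elliptic `W′/ℚ` that is `ℚ`-isomorphic to `49a1^{(−n)}`, `n ≡ 1, 2 (mod 4)`
  squarefree, `7 ∤ n` — on EITHER half of the additive cell — whose two Bernoulli certificates hold for some admissible
  Heegner prime `r` (`analyticRank_eq_one_of_smul_eq_twist_cm7_neg_of_thm120`), and the `(−4n)`-form for globally minimal
  `W`. This is the INERT-half counterpart of c301 g5's Heegner-half T2′ (`analyticRank_eq_one_negTwist_of_thm120_evenDiscr`,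
  KL19 for `X₀(49)` over `ℚ(√−n)`), at the price of the auxiliary field and the second certificate. K12₂″'s implication holds
  on all these `W′` with its conclusion outright (`rankOneTwoConverse_of_smul_eq_twist_cm7_neg_of_thm120`, hypothesis unused).
* §2 **the inert LEAF's conclusion outright**: `ord_{s=1} L(X₀(49)/K, s) = 1` for every imaginary quadratic `K` with
  `d_K = −4n` and the certificates (`analyticRankEK_cm7_eq_one_of_thm120_twist`: Artin formalism `analyticRankEK_cm7`, c201 g0,
  `ord L(X₀(49)) = 0` by CLTZ 1.2) — for `(−n/7) = −1` this is the conclusion of the L-form inert leaf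
  `X049KLevelTwoConverseInertSeven` (c201 g7, p483860) with NO Selmer hypothesis, i.e. BC5-grade rungs of the registered stub
  `stub_inertHalfGenusNonTorsion` (via c201 g7's dictionary `genusPoint_not_isOfFinAddOrder_of_analyticRank_eq_one_cm7`).
* §4 (appended): members `n = 29`, `53` — the first inert-half PRIMES (this seat's new certificates).
* §3 **members** `n = 1, 2, 22` (`784`, `3136⁻`, `49a1^{(−22)}`; all INERT-half: `(−1/7) = (−2/7) = (−22/7) = −1`) from bsd-cm's
  landed certificates `RouteU.norm_generalizedBernoulli_theta1/2_E4/_E8/_E88` (`r = 31, 47, 271`): «D(1)», «D(2)», «D(22)»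
  (`r_an = 1` for every model; cf. c301 g6's unconditional rank-`1` + `Ш[2] = 0` for `784`, `3136⁻` and their `r_an = 1` via the
  bsd.S31 hook — here from KL19 instead, and `49a1^{(−22)}`, `N = 379456`, is beyond every Miller rung), the leaf at `ℚ(i)`,
  `ℚ(√−2)`, `ℚ(√−22)`, and bsd-cm's binder `hr1` of `RouteU.bsdp_seven_of_twist_cm7_E4/_E8/_E88` DISCHARGED with no Selmer input
  (`analyticRank_eq_one_twist_cm7_neg4/neg8/neg88_of_thm120`).

HONEST FRAMING: `p = 7`, RANK axis; witness families (twist-density zero; relative density ≈ 6/7 inside the inert half — kit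
j267736: 178/209 members `n ≤ 1200`); nothing about `p = 2`; K12₂″ and both research stubs stay OPEN; BSD is not proved by
any of this. THEOREMS ONLY (no `def`, no instance, no named fact). Memo `INERT-RUNG-DECISION.md` (HOME, evidence on 20044).

References: [KrizLi2019] Thm. 1.20 (pp. 7–8), Rem. 1.21; [GrossZagier1986] I.(6.3), I.§7; [CoatesLiTianZhai2015] Thm. 1.2;
[MurtyMurty1997] Ch. 6 §1; [SilvermanAEC2009] X.5.4, C.16; [Cox2013] Lemma 1.14.
-/

noncomputable section

open scoped Classical NumberTheorySymbols

open NumberField WeierstrassCurve DirichletCharacter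
open Literature.NumberTheory.EllipticCurves Literature.NumberTheory.EllipticCurves.Rank1Residual
open Literature.NumberTheory.EllipticCurves.KrizLi2019 Literature.NumberTheory.LFunctions
open Literature.NumberTheory.EllipticCurves.ModularForms
open Literature.NumberTheory.QuadraticFields
open Summit.BirchSwinnertonDyer.Rank1Residual
open Summit.BirchSwinnertonDyer.Rank1Residual.X12.O11.RouteU

namespace Summit.BirchSwinnertonDyer.BirchSwinnertonDyer.Theorems.GoldfeldGoodTwists

/-! ## §1 T2″ — «D(n)» over `ℚ` on the double-unit locus, both halves -/

section Dn

variable {n r : ℕ} [hn : NeZero n] [hr : Fact r.Prime]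
  (hn4 : n % 4 = 1 ∨ n % 4 = 2) (hsq : Squarefree n) (h7n : ¬ 7 ∣ n)
  (hr8 : r % 8 = 7) (hr7 : r ≠ 7) (hrn : r.Coprime n)
  (h7split : legendreSym 7 (-(r : ℤ)) = 1)
  (hsplit : ∀ q : ℕ, q.Prime → q ∣ n → q ≠ 2 → J(-(r : ℤ) | q) = 1)
  (hcert₁ : ∀ (ω : DirichletCharacter ℚ_[7] 7), IsTeichmullerCharacter ω →
    ∀ θ : DirichletCharacter ℚ_[7] (7 * (4 * n)),
      (∀ j : ZMod (7 * (4 * n)), θ j =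
        ((if Even j.val then (0 : ℤ) else J(-(n : ℤ) | j.val) : ℤ) : ℚ_[7]) * ω (j.val : ZMod 7) ^ 4) →
      ‖generalizedBernoulli 1 θ‖ = 1)
  (hcert₂ : ∀ (ω : DirichletCharacter ℚ_[7] 7), IsTeichmullerCharacter ω →
    ∀ θ : DirichletCharacter ℚ_[7] (7 * (4 * n) * r),
      (∀ j : ZMod (7 * (4 * n) * r), θ j =
        (((if Even j.val then (0 : ℤ) else J(-(n : ℤ) | j.val)) * J((j.val : ℤ) | r) : ℤ) : ℚ_[7]) *
          ω (j.val : ZMod 7) ^ 1) →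
      ‖generalizedBernoulli 1 θ‖ = 1)
  (h120 : KrizLi2019.thm120_padicLogHeegner_unit_of_bernoulli)
  (hnf : exists_isNewformOf) (h12 : CoatesLiTianZhai2015.thm12_fullBSD_twist)
  (hGZ : ∀ (N : ℕ) [NeZero N] (V : WeierstrassCurve ℚ) (L : Type) [Field L] [NumberField L], gross_zagier N V L)
  (hHP : ∀ (V : WeierstrassCurve ℚ) (L : Type) [Field L] [NumberField L], exists_isHeegnerPoint V L)

include hn4 hsq h7n hr8 hr7 hrn h7split hsplit hcert₁ hcert₂ h120 hnf h12 hGZ hHP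

/-- **T2″ «D(n)» (model-free, no Selmer hypothesis): `ord_{s=1} L(W′, s) = 1` for EVERY elliptic `W′/ℚ` with
`C′ • W′ = 49a1^{(−n)}`**, `n ≡ 1, 2 (mod 4)` squarefree, `7 ∤ n` (either half), on the double-unit locus of an admissible Heegner
prime `r`, granted KL19 Thm. 1.20, Modularity, CLTZ Thm. 1.2 at `R = 1`, Gross–Zagier and Heegner rationality: `r_an(W′)` is odd by
the sign law (`w = sign(−n) = −1`) and the class file's C gives `= 1`. [cite: KrizLi2019, Thm. 1.20 (pp. 7–8) and Rem. 1.21]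
[cite: GrossZagier1986, I.(6.3) and I.§7] [cite: MurtyMurty1997, Ch. 6 §1] -/
theorem analyticRank_eq_one_of_smul_eq_twist_cm7_neg_of_thm120
    (W' : WeierstrassCurve ℚ) [W'.IsElliptic] (C' : VariableChange ℚ)
    (hW' : C' • W' = cm7.quadraticTwist ((-(n : ℤ) : ℤ) : ℚ)) : W'.analyticRank = 1 :=
  analyticRank_eq_one_of_smul_eq_twist_cm7_neg_of_thm120_of_odd hn4 hsq h7n hr8 hr7 hrn h7split hsplit hcert₁ hcert₂ h120
    hnf hGZ hHP W' C' hW'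
    (odd_analyticRank_of_smul_eq_quadraticTwist_cm7_of_neg hnf h12 (d := -(n : ℤ))
      (by rw [← Int.squarefree_natAbs]; simpa using hsq) (by have := hn.out; omega) (by have := hn.out; omega) W' C' hW')

/-- **T2″ for the globally minimal `(−4n)`-models**: `r_an(W) = 1` for every globally minimal `W` with `C • W = 49a1^{(−4n)}`
(`49a1^{(−4n)} = ⟨2⁻¹,0,0,0⟩ • 49a1^{(−n)}`, `quadraticTwist_sq_mul`). [cite: KrizLi2019, Thm. 1.20 (pp. 7–8)] [cite: SilvermanAEC2009, X.5 Prop. 5.4] -/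
theorem analyticRank_eq_one_twist_cm7_even_of_thm120
    (W : WeierstrassCurve ℚ) [W.IsElliptic]
    (hW : ∃ C : VariableChange ℚ, C • W = cm7.quadraticTwist ((-(4 * (n : ℤ)) : ℤ) : ℚ)) : W.analyticRank = 1 := by
  obtain ⟨C, hC⟩ := hW
  have h4 : cm7.quadraticTwist ((-(4 * (n : ℤ)) : ℤ) : ℚ) =
      (⟨(Units.mk0 (2 : ℚ) two_ne_zero)⁻¹, 0, 0, 0⟩ : VariableChange ℚ) • cm7.quadraticTwist ((-(n : ℤ) : ℤ) : ℚ) := by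
    rw [show ((-(4 * (n : ℤ)) : ℤ) : ℚ) = (2 : ℚ) ^ 2 * (((-(n : ℤ)) : ℤ) : ℚ) by push_cast; ring]
    exact cm7.quadraticTwist_sq_mul two_ne_zero _
  refine analyticRank_eq_one_of_smul_eq_twist_cm7_neg_of_thm120 hn4 hsq h7n hr8 hr7 hrn h7split hsplit hcert₁ hcert₂ h120
    hnf h12 hGZ hHP W ((⟨(Units.mk0 (2 : ℚ) two_ne_zero)⁻¹, 0, 0, 0⟩ : VariableChange ℚ)⁻¹ * C) ?_
  rw [mul_smul, hC, h4, inv_smul_smul]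

/-- **K12₂″'s implication on these `W`, conclusion OUTRIGHT** (the registered crux restricted to the globally minimal models of
`49a1^{(−4n)}` on the double-unit locus; the Selmer hypothesis is not used). [cite: KrizLi2019, Thm. 1.20 (pp. 7–8)] -/
theorem rankOneTwoConverse_twist_cm7_even_of_thm120'
    (W : WeierstrassCurve ℚ) [W.IsElliptic] [W.IsGloballyMinimal]
    (hW : ∃ C : VariableChange ℚ, C • W = cm7.quadraticTwist ((-(4 * (n : ℤ)) : ℤ) : ℚ))
    (_hco : W.selmerCorank 2 = 1) : W.analyticRank = 1 :=
  analyticRank_eq_one_twist_cm7_even_of_thm120 hn4 hsq h7n hr8 hr7 hrn h7split hsplit hcert₁ hcert₂ h120 hnf h12 hGZ hHP W hW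

/-! ## §2 The LEAF's conclusion outright: `ord_{s=1} L(X₀(49)/ℚ(√−n), s) = 1` (inert half `(−n/7) = −1` included) -/

/-- **`ord_{s=1} L(X₀(49)/K, s) = 1` for every imaginary quadratic `K` with `d_K = −4n`** on the double-unit locus: Artin formalism
`ord L(X₀(49)/K) = ord L(X₀(49)) + ord L(X₀(49)^{(d_K)}) = 0 + r_an(49a1^{(−4n)})` (`analyticRankEK_cm7`, CLTZ Thm. 1.2 at `R = 1`) and
T2″. For `(−n/7) = −1` (`7` INERT in `K`, no Heegner point of level `49`) this is the conclusion of the inert leaf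
`X049KLevelTwoConverseInertSeven` with NO Selmer hypothesis — the first rungs of the inert half.
[cite: CoatesLiTianZhai2015, Thm. 1.2 (p. 359, case r = 0)] [cite: GrossZagier1986, I.§7] [cite: KrizLi2019, Thm. 1.20 (pp. 7–8)] -/
theorem analyticRankEK_cm7_eq_one_of_thm120_twist
    (K : Type) [Field K] [NumberField K] (hdK : NumberField.discr K = -(4 * (n : ℤ))) : analyticRankEK cm7 K = 1 := by
  have hd : ((-(4 * (n : ℤ)) : ℤ) : ℚ) ≠ 0 := by have := hn.out; exact_mod_cast (show (-(4 * (n : ℤ)) : ℤ) ≠ 0 by omega)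
  haveI := cm7.isElliptic_quadraticTwist hd
  have h4 : cm7.quadraticTwist ((-(4 * (n : ℤ)) : ℤ) : ℚ) =
      (⟨(Units.mk0 (2 : ℚ) two_ne_zero)⁻¹, 0, 0, 0⟩ : VariableChange ℚ) • cm7.quadraticTwist ((-(n : ℤ) : ℤ) : ℚ) := by
    rw [show ((-(4 * (n : ℤ)) : ℤ) : ℚ) = (2 : ℚ) ^ 2 * (((-(n : ℤ)) : ℤ) : ℚ) by push_cast; ring]
    exact cm7.quadraticTwist_sq_mul two_ne_zero _
  rw [analyticRankEK_cm7 (hasEntireLFunction_rat_of_exists_isNewformOf hnf) h12 K, hdK, Int.cast_neg, Int.cast_mul,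
    Int.cast_ofNat, Int.cast_natCast]
  have e : ((-(4 * (n : ℤ)) : ℤ) : ℚ) = -(4 * (n : ℚ)) := by push_cast; ring
  rw [← e]
  refine analyticRank_eq_one_of_smul_eq_twist_cm7_neg_of_thm120 hn4 hsq h7n hr8 hr7 hrn h7split hsplit hcert₁ hcert₂ h120
    hnf h12 hGZ hHP _ ((⟨(Units.mk0 (2 : ℚ) two_ne_zero)⁻¹, 0, 0, 0⟩ : VariableChange ℚ)⁻¹) ?_
  rw [h4, inv_smul_smul]

end Dn

/-! ## §3 Members `n = 1, 2, 22` (INERT half): «D(1)», «D(2)», «D(22)», the leaf at `ℚ(i)`, `ℚ(√−2)`, `ℚ(√−22)`, bsd-cm's `hr1` -/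

section Members

/-- **«D(1)»: `ord_{s=1} L(W′, s) = 1` for every elliptic `W′ ≅ 49a1^{(−1)}` (the curve `784`; INERT half)**, from KL19 Thm. 1.20 for
the twist over `ℚ(√−31)` with bsd-cm's certificates `RouteU.norm_generalizedBernoulli_theta1/2_E4`. Also DISCHARGES the binder `hr1` of
bsd-cm's `RouteU.bsdp_seven_of_twist_cm7_E4` (any globally minimal model, `C⁻¹`). [cite: KrizLi2019, Thm. 1.20 (pp. 7–8) and Rem. 1.21]
[cite: GrossZagier1986, I.(6.3) and I.§7] -/
theorem analyticRank_eq_one_twist_cm7_neg1_of_thm120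
    (h120 : KrizLi2019.thm120_padicLogHeegner_unit_of_bernoulli) (hnf : exists_isNewformOf)
    (h12 : CoatesLiTianZhai2015.thm12_fullBSD_twist)
    (hGZ : ∀ (N : ℕ) [NeZero N] (V : WeierstrassCurve ℚ) (L : Type) [Field L] [NumberField L], gross_zagier N V L)
    (hHP : ∀ (V : WeierstrassCurve ℚ) (L : Type) [Field L] [NumberField L], exists_isHeegnerPoint V L)
    (W' : WeierstrassCurve ℚ) [W'.IsElliptic] (C' : VariableChange ℚ)
    (hW' : C' • W' = cm7.quadraticTwist ((-((1 : ℕ) : ℤ) : ℤ) : ℚ)) : W'.analyticRank = 1 :=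
  analyticRank_eq_one_of_smul_eq_twist_cm7_neg_of_thm120 (n := 1) (r := 31) (hr := ⟨by norm_num⟩)
    (by norm_num) squarefree_one (by norm_num) (by norm_num) (by norm_num) (by norm_num)
    (by rw [legendreSym_eq_ite 7 (by norm_num)]; decide)
    (fun q hq hqn _ => absurd (Nat.dvd_one.mp hqn) hq.ne_one)
    norm_generalizedBernoulli_theta1_E4 norm_generalizedBernoulli_theta2_E4 h120 hnf h12 hGZ hHP W' C' hW'

/-- **«D(1)», globally minimal `(−4)`-form** (bsd-cm's `hW` shape for `E4`): `r_an(W) = 1`. [cite: KrizLi2019, Thm. 1.20 (pp. 7–8)] -/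
theorem analyticRank_eq_one_twist_cm7_neg4_of_thm120
    (h120 : KrizLi2019.thm120_padicLogHeegner_unit_of_bernoulli) (hnf : exists_isNewformOf)
    (h12 : CoatesLiTianZhai2015.thm12_fullBSD_twist)
    (hGZ : ∀ (N : ℕ) [NeZero N] (V : WeierstrassCurve ℚ) (L : Type) [Field L] [NumberField L], gross_zagier N V L)
    (hHP : ∀ (V : WeierstrassCurve ℚ) (L : Type) [Field L] [NumberField L], exists_isHeegnerPoint V L)
    (W : WeierstrassCurve ℚ) [W.IsElliptic]
    (hW : ∃ C : VariableChange ℚ, C • W = cm7.quadraticTwist ((-(4 * ((1 : ℕ) : ℤ)) : ℤ) : ℚ)) : W.analyticRank = 1 :=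
  analyticRank_eq_one_twist_cm7_even_of_thm120 (n := 1) (r := 31) (hr := ⟨by norm_num⟩)
    (by norm_num) squarefree_one (by norm_num) (by norm_num) (by norm_num) (by norm_num)
    (by rw [legendreSym_eq_ite 7 (by norm_num)]; decide)
    (fun q hq hqn _ => absurd (Nat.dvd_one.mp hqn) hq.ne_one)
    norm_generalizedBernoulli_theta1_E4 norm_generalizedBernoulli_theta2_E4 h120 hnf h12 hGZ hHP W hW

/-- **The inert leaf at `K = ℚ(i)` (`d_K = −4`, `7` inert): `ord_{s=1} L(X₀(49)/ℚ(i), s) = 1`**, no Selmer hypothesis.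
[cite: CoatesLiTianZhai2015, Thm. 1.2] [cite: KrizLi2019, Thm. 1.20 (pp. 7–8)] -/
theorem analyticRankEK_cm7_eq_one_discr_neg4_of_thm120
    (h120 : KrizLi2019.thm120_padicLogHeegner_unit_of_bernoulli) (hnf : exists_isNewformOf)
    (h12 : CoatesLiTianZhai2015.thm12_fullBSD_twist)
    (hGZ : ∀ (N : ℕ) [NeZero N] (V : WeierstrassCurve ℚ) (L : Type) [Field L] [NumberField L], gross_zagier N V L)
    (hHP : ∀ (V : WeierstrassCurve ℚ) (L : Type) [Field L] [NumberField L], exists_isHeegnerPoint V L)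
    (K : Type) [Field K] [NumberField K]
    (hdK : NumberField.discr K = -4) : analyticRankEK cm7 K = 1 :=
  analyticRankEK_cm7_eq_one_of_thm120_twist (n := 1) (r := 31) (hr := ⟨by norm_num⟩)
    (by norm_num) squarefree_one (by norm_num) (by norm_num) (by norm_num) (by norm_num)
    (by rw [legendreSym_eq_ite 7 (by norm_num)]; decide)
    (fun q hq hqn _ => absurd (Nat.dvd_one.mp hqn) hq.ne_one)
    norm_generalizedBernoulli_theta1_E4 norm_generalizedBernoulli_theta2_E4 h120 hnf h12 hGZ hHP K (by rw [hdK]; norm_num)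

/-- **«D(2)»: `ord_{s=1} L(W′, s) = 1` for every elliptic `W′ ≅ 49a1^{(−2)}` (the curve `3136⁻`; INERT half)**, auxiliary field
`ℚ(√−47)`, certificates `RouteU.…_E8`. [cite: KrizLi2019, Thm. 1.20 (pp. 7–8) and Rem. 1.21] [cite: GrossZagier1986, I.(6.3) and I.§7] -/
theorem analyticRank_eq_one_twist_cm7_neg2_of_thm120
    (h120 : KrizLi2019.thm120_padicLogHeegner_unit_of_bernoulli) (hnf : exists_isNewformOf)
    (h12 : CoatesLiTianZhai2015.thm12_fullBSD_twist)
    (hGZ : ∀ (N : ℕ) [NeZero N] (V : WeierstrassCurve ℚ) (L : Type) [Field L] [NumberField L], gross_zagier N V L)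
    (hHP : ∀ (V : WeierstrassCurve ℚ) (L : Type) [Field L] [NumberField L], exists_isHeegnerPoint V L)
    (W' : WeierstrassCurve ℚ) [W'.IsElliptic] (C' : VariableChange ℚ)
    (hW' : C' • W' = cm7.quadraticTwist ((-((2 : ℕ) : ℤ) : ℤ) : ℚ)) : W'.analyticRank = 1 :=
  analyticRank_eq_one_of_smul_eq_twist_cm7_neg_of_thm120 (n := 2) (r := 47) (hr := ⟨by norm_num⟩)
    (by norm_num) (show Nat.Prime 2 by norm_num).squarefree (by norm_num) (by norm_num) (by norm_num) (by norm_num)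
    (by rw [legendreSym_eq_ite 7 (by norm_num)]; decide)
    (fun q hq hqn hq2 => absurd ((Nat.prime_dvd_prime_iff_eq hq Nat.prime_two).mp hqn) hq2)
    norm_generalizedBernoulli_theta1_E8 norm_generalizedBernoulli_theta2_E8 h120 hnf h12 hGZ hHP W' C' hW'

/-- **«D(2)», globally minimal `(−8)`-form** (bsd-cm's `hW` shape for `E8`; discharges `hr1` of `RouteU.bsdp_seven_of_twist_cm7_E8`).
[cite: KrizLi2019, Thm. 1.20 (pp. 7–8)] -/
theorem analyticRank_eq_one_twist_cm7_neg8_of_thm120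
    (h120 : KrizLi2019.thm120_padicLogHeegner_unit_of_bernoulli) (hnf : exists_isNewformOf)
    (h12 : CoatesLiTianZhai2015.thm12_fullBSD_twist)
    (hGZ : ∀ (N : ℕ) [NeZero N] (V : WeierstrassCurve ℚ) (L : Type) [Field L] [NumberField L], gross_zagier N V L)
    (hHP : ∀ (V : WeierstrassCurve ℚ) (L : Type) [Field L] [NumberField L], exists_isHeegnerPoint V L)
    (W : WeierstrassCurve ℚ) [W.IsElliptic]
    (hW : ∃ C : VariableChange ℚ, C • W = cm7.quadraticTwist ((-(4 * ((2 : ℕ) : ℤ)) : ℤ) : ℚ)) : W.analyticRank = 1 :=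
  analyticRank_eq_one_twist_cm7_even_of_thm120 (n := 2) (r := 47) (hr := ⟨by norm_num⟩)
    (by norm_num) (show Nat.Prime 2 by norm_num).squarefree (by norm_num) (by norm_num) (by norm_num) (by norm_num)
    (by rw [legendreSym_eq_ite 7 (by norm_num)]; decide)
    (fun q hq hqn hq2 => absurd ((Nat.prime_dvd_prime_iff_eq hq Nat.prime_two).mp hqn) hq2)
    norm_generalizedBernoulli_theta1_E8 norm_generalizedBernoulli_theta2_E8 h120 hnf h12 hGZ hHP W hW

/-- **The inert leaf at `K = ℚ(√−2)` (`d_K = −8`, `7` inert): `ord_{s=1} L(X₀(49)/ℚ(√−2), s) = 1`**, no Selmer hypothesis.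
[cite: CoatesLiTianZhai2015, Thm. 1.2] [cite: KrizLi2019, Thm. 1.20 (pp. 7–8)] -/
theorem analyticRankEK_cm7_eq_one_discr_neg8_of_thm120
    (h120 : KrizLi2019.thm120_padicLogHeegner_unit_of_bernoulli) (hnf : exists_isNewformOf)
    (h12 : CoatesLiTianZhai2015.thm12_fullBSD_twist)
    (hGZ : ∀ (N : ℕ) [NeZero N] (V : WeierstrassCurve ℚ) (L : Type) [Field L] [NumberField L], gross_zagier N V L)
    (hHP : ∀ (V : WeierstrassCurve ℚ) (L : Type) [Field L] [NumberField L], exists_isHeegnerPoint V L)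
    (K : Type) [Field K] [NumberField K]
    (hdK : NumberField.discr K = -8) : analyticRankEK cm7 K = 1 :=
  analyticRankEK_cm7_eq_one_of_thm120_twist (n := 2) (r := 47) (hr := ⟨by norm_num⟩)
    (by norm_num) (show Nat.Prime 2 by norm_num).squarefree (by norm_num) (by norm_num) (by norm_num) (by norm_num)
    (by rw [legendreSym_eq_ite 7 (by norm_num)]; decide)
    (fun q hq hqn hq2 => absurd ((Nat.prime_dvd_prime_iff_eq hq Nat.prime_two).mp hqn) hq2)
    norm_generalizedBernoulli_theta1_E8 norm_generalizedBernoulli_theta2_E8 h120 hnf h12 hGZ hHP K (by rw [hdK]; norm_num)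

/-- **«D(22)»: `ord_{s=1} L(W′, s) = 1` for every elliptic `W′ ≅ 49a1^{(−22)}` (`N = 379456`; INERT half)**, auxiliary field `ℚ(√−271)`,
certificates `RouteU.…_E88`. [cite: KrizLi2019, Thm. 1.20 (pp. 7–8) and Rem. 1.21] [cite: GrossZagier1986, I.(6.3) and I.§7] -/
theorem analyticRank_eq_one_twist_cm7_neg22_of_thm120
    (h120 : KrizLi2019.thm120_padicLogHeegner_unit_of_bernoulli) (hnf : exists_isNewformOf)
    (h12 : CoatesLiTianZhai2015.thm12_fullBSD_twist)
    (hGZ : ∀ (N : ℕ) [NeZero N] (V : WeierstrassCurve ℚ) (L : Type) [Field L] [NumberField L], gross_zagier N V L)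
    (hHP : ∀ (V : WeierstrassCurve ℚ) (L : Type) [Field L] [NumberField L], exists_isHeegnerPoint V L)
    (W' : WeierstrassCurve ℚ) [W'.IsElliptic] (C' : VariableChange ℚ)
    (hW' : C' • W' = cm7.quadraticTwist ((-((22 : ℕ) : ℤ) : ℤ) : ℚ)) : W'.analyticRank = 1 :=
  analyticRank_eq_one_of_smul_eq_twist_cm7_neg_of_thm120 (n := 22) (r := 271) (hr := ⟨by norm_num⟩)
    (by norm_num) (by rw [show (22 : ℕ) = 2 * 11 by norm_num]; exact (Nat.squarefree_mul (by norm_num)).mpr ⟨(show Nat.Prime 2 by norm_num).squarefree, (show Nat.Prime 11 by norm_num).squarefree⟩)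
    (by norm_num) (by norm_num) (by norm_num) (by norm_num)
    (by rw [legendreSym_eq_ite 7 (by norm_num)]; decide)
    (fun q hq hqn hq2 => by
      rcases (Nat.Prime.dvd_mul hq : q ∣ 2 * 11 ↔ _).mp (by simpa using hqn) with h | h
      · exact absurd ((Nat.prime_dvd_prime_iff_eq hq Nat.prime_two).mp h) hq2
      · rw [(Nat.prime_dvd_prime_iff_eq hq (by norm_num : Nat.Prime 11)).mp h,
          jacobiSym_prime_eq_ite 11 (by norm_num) (by norm_num)]; decide)
    norm_generalizedBernoulli_theta1_E88 norm_generalizedBernoulli_theta2_E88 h120 hnf h12 hGZ hHP W' C' hW'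

/-- **«D(22)», globally minimal `(−88)`-form** (bsd-cm's `hW` shape for `E88`; discharges `hr1` of `RouteU.bsdp_seven_of_twist_cm7_E88`).
[cite: KrizLi2019, Thm. 1.20 (pp. 7–8)] -/
theorem analyticRank_eq_one_twist_cm7_neg88_of_thm120
    (h120 : KrizLi2019.thm120_padicLogHeegner_unit_of_bernoulli) (hnf : exists_isNewformOf)
    (h12 : CoatesLiTianZhai2015.thm12_fullBSD_twist)
    (hGZ : ∀ (N : ℕ) [NeZero N] (V : WeierstrassCurve ℚ) (L : Type) [Field L] [NumberField L], gross_zagier N V L)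
    (hHP : ∀ (V : WeierstrassCurve ℚ) (L : Type) [Field L] [NumberField L], exists_isHeegnerPoint V L)
    (W : WeierstrassCurve ℚ) [W.IsElliptic]
    (hW : ∃ C : VariableChange ℚ, C • W = cm7.quadraticTwist ((-(4 * ((22 : ℕ) : ℤ)) : ℤ) : ℚ)) : W.analyticRank = 1 :=
  analyticRank_eq_one_twist_cm7_even_of_thm120 (n := 22) (r := 271) (hr := ⟨by norm_num⟩)
    (by norm_num) (by rw [show (22 : ℕ) = 2 * 11 by norm_num]; exact (Nat.squarefree_mul (by norm_num)).mpr ⟨(show Nat.Prime 2 by norm_num).squarefree, (show Nat.Prime 11 by norm_num).squarefree⟩)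
    (by norm_num) (by norm_num) (by norm_num) (by norm_num)
    (by rw [legendreSym_eq_ite 7 (by norm_num)]; decide)
    (fun q hq hqn hq2 => by
      rcases (Nat.Prime.dvd_mul hq : q ∣ 2 * 11 ↔ _).mp (by simpa using hqn) with h | h
      · exact absurd ((Nat.prime_dvd_prime_iff_eq hq Nat.prime_two).mp h) hq2
      · rw [(Nat.prime_dvd_prime_iff_eq hq (by norm_num : Nat.Prime 11)).mp h,
          jacobiSym_prime_eq_ite 11 (by norm_num) (by norm_num)]; decide)
    norm_generalizedBernoulli_theta1_E88 norm_generalizedBernoulli_theta2_E88 h120 hnf h12 hGZ hHP W hW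

/-- **The inert leaf at `K = ℚ(√−22)` (`d_K = −88`, `7` inert): `ord_{s=1} L(X₀(49)/ℚ(√−22), s) = 1`**, no Selmer hypothesis.
[cite: CoatesLiTianZhai2015, Thm. 1.2] [cite: KrizLi2019, Thm. 1.20 (pp. 7–8)] -/
theorem analyticRankEK_cm7_eq_one_discr_neg88_of_thm120
    (h120 : KrizLi2019.thm120_padicLogHeegner_unit_of_bernoulli) (hnf : exists_isNewformOf)
    (h12 : CoatesLiTianZhai2015.thm12_fullBSD_twist)
    (hGZ : ∀ (N : ℕ) [NeZero N] (V : WeierstrassCurve ℚ) (L : Type) [Field L] [NumberField L], gross_zagier N V L)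
    (hHP : ∀ (V : WeierstrassCurve ℚ) (L : Type) [Field L] [NumberField L], exists_isHeegnerPoint V L)
    (K : Type) [Field K] [NumberField K]
    (hdK : NumberField.discr K = -88) : analyticRankEK cm7 K = 1 :=
  analyticRankEK_cm7_eq_one_of_thm120_twist (n := 22) (r := 271) (hr := ⟨by norm_num⟩)
    (by norm_num) (by rw [show (22 : ℕ) = 2 * 11 by norm_num]; exact (Nat.squarefree_mul (by norm_num)).mpr ⟨(show Nat.Prime 2 by norm_num).squarefree, (show Nat.Prime 11 by norm_num).squarefree⟩)
    (by norm_num) (by norm_num) (by norm_num) (by norm_num)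
    (by rw [legendreSym_eq_ite 7 (by norm_num)]; decide)
    (fun q hq hqn hq2 => by
      rcases (Nat.Prime.dvd_mul hq : q ∣ 2 * 11 ↔ _).mp (by simpa using hqn) with h | h
      · exact absurd ((Nat.prime_dvd_prime_iff_eq hq Nat.prime_two).mp h) hq2
      · rw [(Nat.prime_dvd_prime_iff_eq hq (by norm_num : Nat.Prime 11)).mp h,
          jacobiSym_prime_eq_ite 11 (by norm_num) (by norm_num)]; decide)
    norm_generalizedBernoulli_theta1_E88 norm_generalizedBernoulli_theta2_E88 h120 hnf h12 hGZ hHP K (by rw [hdK]; norm_num)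


end Members

/-! ## §4 (appended) Members `n = 29`, `n = 53` — the first inert-half PRIMES, from this seat's new certificates (p497563, Member53) -/

section MembersPrime

/-- **«D(29)»: `ord_{s=1} L(W′, s) = 1` for every elliptic `W′ ≅ 49a1^{(−29)}`** (the FIRST prime of the inert-half family, `N = 659344`; `7` inert in `ℚ(√−29)`), from
KL19 Thm. 1.20 for the twist over `ℚ(√−103)` with this seat's NEW certificates `norm_generalizedBernoulli_theta1/2_n29` (p497563: `7 ∥ S₁(29)`, `7 ∥ S₂(29,103)` in 9 blocks); no
Selmer hypothesis. [cite: KrizLi2019, Thm. 1.20 (pp. 7–8) and Rem. 1.21] [cite: GrossZagier1986, I.(6.3) and I.§7] -/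
theorem analyticRank_eq_one_twist_cm7_neg29_of_thm120
    (h120 : KrizLi2019.thm120_padicLogHeegner_unit_of_bernoulli) (hnf : exists_isNewformOf)
    (h12 : CoatesLiTianZhai2015.thm12_fullBSD_twist)
    (hGZ : ∀ (N : ℕ) [NeZero N] (V : WeierstrassCurve ℚ) (L : Type) [Field L] [NumberField L], gross_zagier N V L)
    (hHP : ∀ (V : WeierstrassCurve ℚ) (L : Type) [Field L] [NumberField L], exists_isHeegnerPoint V L)
    (W' : WeierstrassCurve ℚ) [W'.IsElliptic] (C' : VariableChange ℚ)
    (hW' : C' • W' = cm7.quadraticTwist ((-((29 : ℕ) : ℤ) : ℤ) : ℚ)) : W'.analyticRank = 1 :=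
  analyticRank_eq_one_of_smul_eq_twist_cm7_neg_of_thm120 (n := 29) (r := 103) (hr := ⟨by norm_num⟩)
    (by norm_num) (show Nat.Prime 29 by norm_num).squarefree (by norm_num) (by norm_num) (by norm_num) (by norm_num)
    (by rw [legendreSym_eq_ite 7 (by norm_num)]; decide)
    (fun q hq hqn _ => by rw [(Nat.prime_dvd_prime_iff_eq hq (by norm_num : Nat.Prime 29)).mp hqn, jacobiSym_prime_eq_ite 29 (by norm_num) (by norm_num)]; decide)
    norm_generalizedBernoulli_theta1_n29 norm_generalizedBernoulli_theta2_n29 h120 hnf h12 hGZ hHP W' C' hW'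

/-- **The inert leaf at `K = ℚ(√−29)` (`d_K = −116`, `7` inert): `ord_{s=1} L(X₀(49)/ℚ(√−29), s) = 1`**, no Selmer hypothesis —
the conclusion of `X049KLevelTwoConverseInertSeven` at this `K` outright. [cite: CoatesLiTianZhai2015, Thm. 1.2] [cite: KrizLi2019, Thm. 1.20 (pp. 7–8)] -/
theorem analyticRankEK_cm7_eq_one_discr_neg116_of_thm120
    (h120 : KrizLi2019.thm120_padicLogHeegner_unit_of_bernoulli) (hnf : exists_isNewformOf)
    (h12 : CoatesLiTianZhai2015.thm12_fullBSD_twist)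
    (hGZ : ∀ (N : ℕ) [NeZero N] (V : WeierstrassCurve ℚ) (L : Type) [Field L] [NumberField L], gross_zagier N V L)
    (hHP : ∀ (V : WeierstrassCurve ℚ) (L : Type) [Field L] [NumberField L], exists_isHeegnerPoint V L)
    (K : Type) [Field K] [NumberField K] (hdK : NumberField.discr K = -116) : analyticRankEK cm7 K = 1 :=
  analyticRankEK_cm7_eq_one_of_thm120_twist (n := 29) (r := 103) (hr := ⟨by norm_num⟩)
    (by norm_num) (show Nat.Prime 29 by norm_num).squarefree (by norm_num) (by norm_num) (by norm_num) (by norm_num)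
    (by rw [legendreSym_eq_ite 7 (by norm_num)]; decide)
    (fun q hq hqn _ => by rw [(Nat.prime_dvd_prime_iff_eq hq (by norm_num : Nat.Prime 29)).mp hqn, jacobiSym_prime_eq_ite 29 (by norm_num) (by norm_num)]; decide)
    norm_generalizedBernoulli_theta1_n29 norm_generalizedBernoulli_theta2_n29 h120 hnf h12 hGZ hHP K (by rw [hdK]; norm_num)

/-- **«D(53)»: `ord_{s=1} L(W′, s) = 1` for every elliptic `W′ ≅ 49a1^{(−53)}`** (third prime of the inert-half family, `N = 2202256`; `7` inert in `ℚ(√−53)`), from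
KL19 Thm. 1.20 for the twist over `ℚ(√−47)` with this seat's NEW certificates `norm_generalizedBernoulli_theta1/2_n53` (`7 ∥ S₁(53)`, `7 ∥ S₂(53,47)` in 7 blocks); no
Selmer hypothesis. [cite: KrizLi2019, Thm. 1.20 (pp. 7–8) and Rem. 1.21] [cite: GrossZagier1986, I.(6.3) and I.§7] -/
theorem analyticRank_eq_one_twist_cm7_neg53_of_thm120
    (h120 : KrizLi2019.thm120_padicLogHeegner_unit_of_bernoulli) (hnf : exists_isNewformOf)
    (h12 : CoatesLiTianZhai2015.thm12_fullBSD_twist)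
    (hGZ : ∀ (N : ℕ) [NeZero N] (V : WeierstrassCurve ℚ) (L : Type) [Field L] [NumberField L], gross_zagier N V L)
    (hHP : ∀ (V : WeierstrassCurve ℚ) (L : Type) [Field L] [NumberField L], exists_isHeegnerPoint V L)
    (W' : WeierstrassCurve ℚ) [W'.IsElliptic] (C' : VariableChange ℚ)
    (hW' : C' • W' = cm7.quadraticTwist ((-((53 : ℕ) : ℤ) : ℤ) : ℚ)) : W'.analyticRank = 1 :=
  analyticRank_eq_one_of_smul_eq_twist_cm7_neg_of_thm120 (n := 53) (r := 47) (hr := ⟨by norm_num⟩)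
    (by norm_num) (show Nat.Prime 53 by norm_num).squarefree (by norm_num) (by norm_num) (by norm_num) (by norm_num)
    (by rw [legendreSym_eq_ite 7 (by norm_num)]; decide)
    (fun q hq hqn _ => by rw [(Nat.prime_dvd_prime_iff_eq hq (by norm_num : Nat.Prime 53)).mp hqn, jacobiSym_prime_eq_ite 53 (by norm_num) (by norm_num)]; decide)
    norm_generalizedBernoulli_theta1_n53 norm_generalizedBernoulli_theta2_n53 h120 hnf h12 hGZ hHP W' C' hW'

/-- **The inert leaf at `K = ℚ(√−53)` (`d_K = −212`, `7` inert): `ord_{s=1} L(X₀(49)/ℚ(√−53), s) = 1`**, no Selmer hypothesis —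
the conclusion of `X049KLevelTwoConverseInertSeven` at this `K` outright. [cite: CoatesLiTianZhai2015, Thm. 1.2] [cite: KrizLi2019, Thm. 1.20 (pp. 7–8)] -/
theorem analyticRankEK_cm7_eq_one_discr_neg212_of_thm120
    (h120 : KrizLi2019.thm120_padicLogHeegner_unit_of_bernoulli) (hnf : exists_isNewformOf)
    (h12 : CoatesLiTianZhai2015.thm12_fullBSD_twist)
    (hGZ : ∀ (N : ℕ) [NeZero N] (V : WeierstrassCurve ℚ) (L : Type) [Field L] [NumberField L], gross_zagier N V L)
    (hHP : ∀ (V : WeierstrassCurve ℚ) (L : Type) [Field L] [NumberField L], exists_isHeegnerPoint V L)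
    (K : Type) [Field K] [NumberField K] (hdK : NumberField.discr K = -212) : analyticRankEK cm7 K = 1 :=
  analyticRankEK_cm7_eq_one_of_thm120_twist (n := 53) (r := 47) (hr := ⟨by norm_num⟩)
    (by norm_num) (show Nat.Prime 53 by norm_num).squarefree (by norm_num) (by norm_num) (by norm_num) (by norm_num)
    (by rw [legendreSym_eq_ite 7 (by norm_num)]; decide)
    (fun q hq hqn _ => by rw [(Nat.prime_dvd_prime_iff_eq hq (by norm_num : Nat.Prime 53)).mp hqn, jacobiSym_prime_eq_ite 53 (by norm_num) (by norm_num)]; decide)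
    norm_generalizedBernoulli_theta1_n53 norm_generalizedBernoulli_theta2_n53 h120 hnf h12 hGZ hHP K (by rw [hdK]; norm_num)

end MembersPrime

end Summit.BirchSwinnertonDyer.BirchSwinnertonDyer.Theorems.GoldfeldGoodTwists

end
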